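import Summits.Parity.GeneralizedHardyLittlewood.Theorems.TwinLowerDensityToGHLUniformUpperBound
import Summits.Parity.GeneralizedHardyLittlewood.Theorems.PairsToGHL.Negative.ShiftPairDictionary
import HarnessLib

/-!
# Brun–Titchmarsh for prime pairs, uniformly in the shift (crux `TwinLowerDensityToGHL`, stmt-Parity-18380)

The `t = 2`, unit-slope slice of the uniform upper bound `uniformUpperBound`
(`Theorems/TwinLowerDensityToGHLUniformUpperBound.lean`) through the tree's dictionary for the system
`(n, n + h)` on `K = [-N, N]` (`vonMangoldtSum_shiftPairSystem`, `archFactor_shiftPairSystem`,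
`singularProduct_shiftPairSystem` of `Theorems/PairsToGHL/Negative/ShiftPairDictionary.lean`): ONE constant
`C` with

  `∑_{n ≤ N} Λ(n) Λ(n + h) ≤ C · ∏_p β_p((n, n+h)) · N + ε N`   for ALL `1 ≤ h ≤ N`, `N ≥ N₀(ε)`

(`pairUpperBound_uniformShift`), and for even `h` the singular product is the classical
`𝔖(h) = 2 C₂ ∏_{p ∣ h, p > 2} (p − 1)/(p − 2)` (`pairUpperBound_uniformShift_even`).  The two-sided version
(error `≤ ε N`, uniformly in `h ≤ N`) is the pair slice of `GeneralizedHardyLittlewoodDimOne` (stmt-Parity-0819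
= the conclusion of the registered stub `stub_shiftLift`) and FAILS at `h = 2q`, `N = q^{10}` in the illusory
world (tree `not_generalizedHardyLittlewoodDimOne_of_unboundedSiegelZeros`, mod Matomäki–Merikoski); the
upper half with a constant is what the sieve gives unconditionally and uniformly.

References: H. Halberstam, H.-E. Richert, *Sieve Methods* (1974), Thm. 2.5, §5.7 [HalberstamRichert1974];
B. Green, T. Tao, Ann. of Math. 171 (2010), Example 1, (1.2), (1.4), (1.7) [GreenTao2010].
-/

noncomputable section

open Finset Filter
open scoped ArithmeticFunction.vonMangoldt

namespace Summit.Parity.GeneralizedHardyLittlewood.TwinLowerDensityToGHLUniformUpperBound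

open Literature.NumberTheory.Sieve
open Summit.Parity.GeneralizedHardyLittlewood.Theorems.PairsToGHL.Negative

/-- **Brun–Titchmarsh for prime pairs, UNIFORMLY in the shift**: there is `C > 0` such that for every
`ε > 0`, for all large `N` and ALL shifts `1 ≤ h ≤ N`,
`∑_{n ≤ N} Λ(n) Λ(n + h) ≤ C · ∏_p β_p((n, n+h)) · N + ε N`
(the `(t, L) = (2, 3)` instance of `uniformUpperBound` on `(n, n + h)`, `K = [-N, N]`: weighted sum
`= ∑_{n ≤ N} Λ(n)Λ(n+h)`, `β_∞ = N`). [cite: HalberstamRichert1974, Thm. 2.5 and §5.7]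
[cite: GreenTao2010, Example 1] -/
theorem pairUpperBound_uniformShift :
    ∃ C : ℝ, 0 < C ∧ ∀ ε : ℝ, 0 < ε → ∃ N₀ : ℕ, ∀ N : ℕ, N₀ ≤ N → ∀ h : ℕ, 1 ≤ h → h ≤ N →
      ∑ n ∈ Icc 1 N, Λ n * Λ (n + h) ≤
        C * ((N : ℝ) * singularProduct (shiftPairSystem (h : ℤ))) + ε * N := by
  obtain ⟨C, hC, hmain⟩ := uniformUpperBound 2 3 (by norm_num)
  refine ⟨C, hC, fun ε hε => ?_⟩
  obtain ⟨N₀, hN₀⟩ := hmain ε hε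
  refine ⟨max N₀ 1, fun N hN h hh hhN => ?_⟩
  have hNpos : 0 < N := lt_of_lt_of_le zero_lt_one (le_of_max_le_right hN)
  have hh0 : h ≠ 0 := by omega
  have key := hN₀ N (le_of_max_le_left hN) (shiftPairSystem (h : ℤ))
    (isNondegenerateSystem_shiftPairSystem_iff.mpr (by exact_mod_cast hh0))
    (affLinSize_shiftPairSystem_le hNpos hhN) (realBox 1 N) (convex_Icc _ _) subset_rfl
  rwa [vonMangoldtSum_shiftPairSystem, archFactor_shiftPairSystem] at key

/-- **The same with the classical singular series** for EVEN shifts: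
`∑_{n ≤ N} Λ(n) Λ(n + h) ≤ C · 𝔖(h) · N + ε N`, `𝔖(h) = 2 C₂ ∏_{p ∣ h, p > 2} (p − 1)/(p − 2)`
(`goldbachSingularSeries`), uniformly in even `h ≤ N` (tree `singularProduct_shiftPairSystem`).
[cite: GreenTao2010, Example 1 and (1.7)] -/
theorem pairUpperBound_uniformShift_even :
    ∃ C : ℝ, 0 < C ∧ ∀ ε : ℝ, 0 < ε → ∃ N₀ : ℕ, ∀ N : ℕ, N₀ ≤ N → ∀ h : ℕ, Even h → 1 ≤ h → h ≤ N →
      ∑ n ∈ Icc 1 N, Λ n * Λ (n + h) ≤ C * (goldbachSingularSeries h * N) + ε * N := by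
  obtain ⟨C, hC, hmain⟩ := pairUpperBound_uniformShift
  refine ⟨C, hC, fun ε hε => ?_⟩
  obtain ⟨N₀, hN₀⟩ := hmain ε hε
  refine ⟨N₀, fun N hN h he hh hhN => ?_⟩
  have key := hN₀ N hN h hh hhN
  rw [singularProduct_shiftPairSystem he (by omega), mul_comm (N : ℝ)] at key
  exact key

/-- **Brun–Titchmarsh for prime pairs with the classical singular series, uniformly in ALL shifts**:
`∑_{n ≤ N} Λ(n) Λ(n + h) ≤ C · 𝔖(h) · N + ε N` for all `1 ≤ h ≤ N`, `N ≥ N₀(ε)` (`𝔖(h) = goldbachSingularSeries h`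
is `0` for odd `h` — then the local factor at `2` of `(n, n + h)` vanishes, `β₂ = 1 − 1/(2−1)² = 0`, so does
`∏_p β_p`, and the bound reads `≤ ε N`; the even case is `singularProduct_shiftPairSystem`; cf. the tree's
`GallagherBackwards.singularProduct_shiftPairSystem_eq`). [cite: HalberstamRichert1974, Thm. 2.5 and §5.7]
[cite: GreenTao2010, Example 1 and (1.7)] -/
theorem pairUpperBound_uniformShift_classical :
    ∃ C : ℝ, 0 < C ∧ ∀ ε : ℝ, 0 < ε → ∃ N₀ : ℕ, ∀ N : ℕ, N₀ ≤ N → ∀ h : ℕ, 1 ≤ h → h ≤ N →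
      ∑ n ∈ Icc 1 N, Λ n * Λ (n + h) ≤ C * (goldbachSingularSeries h * N) + ε * N := by
  obtain ⟨C, hC, hmain⟩ := pairUpperBound_uniformShift
  refine ⟨C, hC, fun ε hε => ?_⟩
  obtain ⟨N₀, hN₀⟩ := hmain ε hε
  refine ⟨N₀, fun N hN h hh hhN => ?_⟩
  have key := hN₀ N hN h hh hhN
  have h0 : h ≠ 0 := by omega
  have hSP : singularProduct (shiftPairSystem (h : ℤ)) = goldbachSingularSeries h := by
    rcases Nat.even_or_odd h with he | ho
    · exact singularProduct_shiftPairSystem he h0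
    · have h2 : ¬ 2 ∣ h := fun hd => (Nat.not_even_iff_odd.mpr ho) (even_iff_two_dvd.mpr hd)
      have hβ : localFactor (shiftPairSystem (h : ℤ)) 2 = 0 := by
        rw [localFactor_shiftPairSystem_of_not_dvd Nat.prime_two h2]; norm_num
      have hnd : IsNondegenerateSystem (shiftPairSystem (h : ℤ)) :=
        isNondegenerateSystem_shiftPairSystem_iff.mpr (by exact_mod_cast h0)
      rw [singularProduct_eq_zero_of_localFactor_eq_zero _ hnd Nat.prime_two hβ]
      unfold goldbachSingularSeries
      rw [if_pos ho]
  rw [hSP, mul_comm (N : ℝ)] at key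
  exact key

end Summit.Parity.GeneralizedHardyLittlewood.TwinLowerDensityToGHLUniformUpperBound

end
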